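import Summits.CriticalPhenomena.PercolationContinuityZ3.Theorems.PercNearOneGluingAdditiveGluingFingerTwoTouched
import Summits.CriticalPhenomena.PercolationContinuityZ3.Theorems.PercNearOneGluingAdditiveGluingTFingers
import HarnessLib

/-! # Crux `PercNearOneGluing.AdditiveGluing` (stmt-CriticalPhenomena-4576) — `AdditiveGluing` for finger observers whose fingers touch at most
# TWO relays, for every relay set `A` (seat (b) V⁺-form, depth prover `png-dp-vplus`)

Support file (`--supports stmt-CriticalPhenomena-4576`); no definitions, no named facts.

* `additiveGluing_fingers_of_FML3_gen` — the most flexible form of the reduction `additiveGluing_fingers_of_FML3_at`: the finger multi-edge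
  Lemma 3 is required only for the weighting `K` = `w` with the pairs at `o` killed, for finger blocks `N` (every `v ∈ N` is a neighbour of `o`
  outside `A`; `K` agrees with `w` off `o`), so that a caller can feed in any structural information about the fingers.
* `additiveGluing_fingers_twoRelays` — **Theorem.**  Let `o ∉ A ∋ b` and suppose every non-relay vertex `x ≠ o` with `w(o,x) > 0` is a finger
  (positive-weight pairs only to `o` and to relays) and all these fingers together touch at most two relays `w₁, w₂ ≠ b`.  Then for every `t ≥ 0`
  with `μ_w(a↔b) ≥ 1 − t` on `A`: `μ_w(o ↔ A) − t ≤ μ_w(o ↔ b)` — `AdditiveGluing` for this class, for EVERY `|A|` and any number of fingers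
  (Kozma–Nitzan's Theorem 5 is one free neighbour; here arbitrarily many mutually supporting free neighbours sharing two relays).
[cite: KozmaNitzan2024, Thms 4–5 (pp. 12–14), Lemma 3 (pp. 6–7), §4 p. 20, Question 7 and Question 9 (p. 36)]
-/

namespace Summit.CriticalPhenomena.PercolationContinuityZ3.Theorems

open MeasureTheory Set
open Literature.Probability.LatticeModels (prodBernoulli)
open Literature.Probability.Percolation (BondConfig openConn openGraph)
open scoped BigOperators Classical

noncomputable section

section FingersTwoRelays

open Literature.Probability.Percolation

variable {n : ℕ}

/-- **`AdditiveGluing` for finger observers from FML3 for the blocks that occur (general form).**  As `additiveGluing_fingers_of_FML3_at`, but the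
hypothesis `hFML3A` receives the finger facts (`v ≠ o`, `w(o,v) ≠ 0` for `v ∈ N`) and the relation `K(x,y) = w(x,y)` off `o` of the weighting `K`
in which it is applied. [cite: KozmaNitzan2024, Thm 5 (pp. 13–14), Lemma 3(i) (pp. 6–7), Question 9 (p. 36)] -/
theorem additiveGluing_fingers_of_FML3_gen
    (w : Sym2 (Fin n) → unitInterval) (A : Finset (Fin n)) (o b : Fin n) (hb : b ∈ A) (ho : o ∉ A)
    (hFML3A : ∀ (K : Sym2 (Fin n) → unitInterval) (N : Finset (Fin n)) (d : Fin n),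
      Disjoint N A → N.Nonempty → d ∈ A →
      (∀ v ∈ N, v ≠ o ∧ (w s(o, v) : ℝ) ≠ 0) →
      (∀ x y : Fin n, x ≠ o → y ≠ o → (K s(x, y) : ℝ) = (w s(x, y) : ℝ)) →
      (∀ v ∈ N, ∀ y : Fin n, y ∉ A → y ∉ N → (K s(v, y) : ℝ) = 0) →
      (∀ a ∈ A, (prodBernoulli K).real (openConn d b) ≤ (prodBernoulli K).real (openConn a b)) →
      (prodBernoulli (fun e' : Sym2 (Fin n) => if (∀ y ∈ e', y ∈ N) ∧ ¬ e'.IsDiag then 1 else K e')).real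
          ({ω : Set (Sym2 (Fin n)) | ∃ v ∈ N, ∃ a ∈ A, s(v, a) ∈ ω} ∩ openConn d b) ≤
        (prodBernoulli (fun e' : Sym2 (Fin n) => if (∀ y ∈ e', y ∈ N) ∧ ¬ e'.IsDiag then 1 else K e')).real
          ({ω : Set (Sym2 (Fin n)) | ∃ v ∈ N, ∃ a ∈ A, s(v, a) ∈ ω} ∩ ⋃ v ∈ N, openConn v b))
    (hfing : ∀ x : Fin n, x ∉ A → x ≠ o → (w s(o, x) : ℝ) ≠ 0 →
      ∀ y : Fin n, y ∉ A → y ≠ o → y ≠ x → (w s(x, y) : ℝ) = 0) :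
    ∀ t : ℝ, 0 ≤ t →
      (∀ a ∈ A, 1 - t ≤ (prodBernoulli w).real (openConn a b)) →
      (prodBernoulli w).real (⋃ a ∈ A, openConn o a) - t ≤ (prodBernoulli w).real (openConn o b) := by
  intro t _ hA
  have hSA : Disjoint ({o} : Finset (Fin n)) A := Finset.disjoint_singleton_left.2 ho
  -- Question-9 designation of `o`: a minimiser of the star-killed two-point function
  obtain ⟨e, he, hmin⟩ := Finset.exists_min_image A
    (fun a => (prodBernoulli (fun e' : Sym2 (Fin n) =>
      if (∃ y ∈ e', y ∈ ({o} : Finset (Fin n))) then (0 : unitInterval) else w e')).real (openConn a b)) ⟨b, hb⟩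
  have hcert := T_block_certificate w A {o} e b hb hSA he hmin
  -- the free layers of positive mass are finger blocks, on which FML3 gives a non-negative bracket
  have hsum : 0 ≤ ∑ N ∈ (Finset.univ : Finset (Finset (Fin n))).filter (fun N => N.Nonempty ∧ Disjoint N A),
      (prodBernoulli (fun e' : Sym2 (Fin n) =>
          if (∀ y ∈ e', y ∈ ({o} : Finset (Fin n))) ∧ ¬ e'.IsDiag then 1 else w e')).real
          {ω : BondConfig (Fin n) | ∀ y : Fin n, y ∈ N ↔ (y ∉ ({o} : Finset (Fin n)) ∧
            ∃ o' ∈ ({o} : Finset (Fin n)), s(o', y) ∈ ω)} *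
        ((prodBernoulli (fun e' : Sym2 (Fin n) =>
            if (∀ y ∈ e', y ∈ N) ∧ ¬ e'.IsDiag then 1 else
              if (∃ y ∈ e', y ∈ ({o} : Finset (Fin n))) then 0 else w e')).real
            (⋃ v ∈ N, ⋃ a ∈ A, openConn v a)ᶜ +
          (prodBernoulli (fun e' : Sym2 (Fin n) =>
            if (∀ y ∈ e', y ∈ N) ∧ ¬ e'.IsDiag then 1 else
              if (∃ y ∈ e', y ∈ ({o} : Finset (Fin n))) then 0 else w e')).real
            (⋃ v ∈ N, openConn v b) -
          (prodBernoulli (fun e' : Sym2 (Fin n) =>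
            if (∀ y ∈ e', y ∈ N) ∧ ¬ e'.IsDiag then 1 else
              if (∃ y ∈ e', y ∈ ({o} : Finset (Fin n))) then 0 else w e')).real
            (openConn e b)) := by
    refine Finset.sum_nonneg fun N hN => ?_
    obtain ⟨hNne, hNA⟩ := (Finset.mem_filter.1 hN).2
    by_cases hbad : ∃ y ∈ N, y = o ∨ (w s(o, y) : ℝ) = 0
    · -- a layer containing `o` itself or a non-neighbour of `o` has mass `0`
      obtain ⟨y, hyN, hy⟩ := hbad
      have hw0 : (prodBernoulli (fun e' : Sym2 (Fin n) =>
          if (∀ y ∈ e', y ∈ ({o} : Finset (Fin n))) ∧ ¬ e'.IsDiag then 1 else w e')).real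
          {ω : BondConfig (Fin n) | ∀ y : Fin n, y ∈ N ↔ (y ∉ ({o} : Finset (Fin n)) ∧
            ∃ o' ∈ ({o} : Finset (Fin n)), s(o', y) ∈ ω)} = 0 := by
        rcases hy with rfl | hy0
        · exact (T_layer_empty_of_mem {y} N y hyN (Finset.mem_singleton_self y)).symm ▸ measureReal_empty
        · by_cases hyo : y = o
          · subst hyo
            exact (T_layer_empty_of_mem {y} N y hyN (Finset.mem_singleton_self y)).symm ▸ measureReal_empty
          · refine T_layer_null w {o} N y hyN (by simpa using hyo) fun v hv => ?_
            rw [Finset.mem_singleton.1 hv]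
            exact hy0
      rw [hw0, zero_mul]
    · -- all of `N` are fingers: apply FML3 in the star-killed weighting
      push Not at hbad
      refine mul_nonneg measureReal_nonneg ?_
      set K : Sym2 (Fin n) → unitInterval :=
        fun e' => if (∃ y ∈ e', y ∈ ({o} : Finset (Fin n))) then (0 : unitInterval) else w e' with hK
      have hfreeK : ∀ v ∈ N, ∀ y : Fin n, y ∉ A → y ∉ N → (K s(v, y) : ℝ) = 0 := by
        intro v hv y hyA hyN
        by_cases hoy : ∃ z ∈ s(v, y), z ∈ ({o} : Finset (Fin n))
        · simp only [hK, hoy, if_true]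
          rfl
        · simp only [hK, hoy, if_false]
          have hvo : v ≠ o := (hbad v hv).1
          have hyo : y ≠ o := fun h => hoy ⟨y, Sym2.mem_mk_right v y, Finset.mem_singleton.2 h⟩
          have hvA : v ∉ A := Finset.disjoint_left.1 hNA hv
          have hyv : y ≠ v := fun h => hyN (h ▸ hv)
          exact hfing v hvA hvo (hbad v hv).2 y hyA hyo hyv
      have hK0 : ∀ x y : Fin n, x ≠ o → y ≠ o → (K s(x, y) : ℝ) = (w s(x, y) : ℝ) := by
        intro x y hxo hyo
        have hno : ¬ (∃ z ∈ s(x, y), z ∈ ({o} : Finset (Fin n))) := by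
          rintro ⟨z, hz, hzo⟩
          rw [Finset.mem_singleton] at hzo
          subst hzo
          rcases Sym2.mem_iff.1 hz with h | h
          · exact hxo h.symm
          · exact hyo h.symm
        simp only [hK, hno, if_false]
      have hfingers : ∀ v ∈ N, v ≠ o ∧ (w s(o, v) : ℝ) ≠ 0 := fun v hv => hbad v hv
      have hX1 := hFML3A K N e hNA hNne he hfingers hK0 hfreeK hmin
      exact T_finger_nonneg_of_X1 K A N e b hNA hfreeK hX1
  -- assemble: `T_e^{w}(o) ≥ 0`, then the additive inequality at level `t`
  have h1 : (prodBernoulli (fun e' : Sym2 (Fin n) =>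
      if (∃ y ∈ e', y ∈ ({o} : Finset (Fin n))) then (0 : unitInterval) else w e')).real (openConn e b) ≤ 1 :=
    measureReal_le_one
  have h2 : 0 ≤ (prodBernoulli (fun e' : Sym2 (Fin n) =>
          if (∀ y ∈ e', y ∈ ({o} : Finset (Fin n))) ∧ ¬ e'.IsDiag then 1 else w e')).real
          {ω : BondConfig (Fin n) | ∀ y : Fin n, y ∈ (∅ : Finset (Fin n)) ↔ (y ∉ ({o} : Finset (Fin n)) ∧
            ∃ o' ∈ ({o} : Finset (Fin n)), s(o', y) ∈ ω)} := measureReal_nonneg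
  have hT : 0 ≤ (prodBernoulli (fun e' : Sym2 (Fin n) =>
          if (∀ y ∈ e', y ∈ ({o} : Finset (Fin n))) ∧ ¬ e'.IsDiag then 1 else w e')).real
          (⋃ v ∈ ({o} : Finset (Fin n)), ⋃ a ∈ A, openConn v a)ᶜ +
        (prodBernoulli (fun e' : Sym2 (Fin n) =>
          if (∀ y ∈ e', y ∈ ({o} : Finset (Fin n))) ∧ ¬ e'.IsDiag then 1 else w e')).real
          (⋃ v ∈ ({o} : Finset (Fin n)), openConn v b) -
        (prodBernoulli (fun e' : Sym2 (Fin n) =>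
          if (∀ y ∈ e', y ∈ ({o} : Finset (Fin n))) ∧ ¬ e'.IsDiag then 1 else w e')).real
          (openConn e b) := by
    nlinarith
  rw [goodStep24_glue_singleton w o] at hT
  simp only [Finset.mem_singleton, Set.iUnion_iUnion_eq_left] at hT
  have hc : (prodBernoulli w).real (⋃ a ∈ A, openConn o a)ᶜ = 1 - (prodBernoulli w).real (⋃ a ∈ A, openConn o a) := by
    rw [measureReal_compl (MeasurableSet.of_discrete), probReal_univ]
  rw [hc] at hT
  have hAe := hA e he
  linarith


/-- **`AdditiveGluing` for finger observers whose fingers touch at most two relays.**  `b ∈ A`, `o ∉ A`; every non-relay vertex `x ≠ o` with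
`w(o,x) > 0` has positive-weight pairs only to `o` and to relays among `{w₁, w₂}` (`w₁, w₂ ≠ b`).  Then for every `t ≥ 0` with `μ_w(a↔b) ≥ 1 − t`
on `A`: `μ_w(o ↔ A) − t ≤ μ_w(o ↔ b)` — for every relay set `A` and any number of fingers.  (`additiveGluing_fingers_of_FML3_gen` +
`fingerML3_twoTouched`.)  [cite: KozmaNitzan2024, Thms 4–5 (pp. 12–14), Lemma 3 (pp. 6–7), §4 p. 20, Question 7 (p. 36)] -/
theorem additiveGluing_fingers_twoRelays
    (w : Sym2 (Fin n) → unitInterval) (A : Finset (Fin n)) (o b w₁ w₂ : Fin n) (hb : b ∈ A) (ho : o ∉ A)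
    (hw₁b : w₁ ≠ b) (hw₂b : w₂ ≠ b)
    (hfing : ∀ x : Fin n, x ∉ A → x ≠ o → (w s(o, x) : ℝ) ≠ 0 →
      ∀ y : Fin n, y ∉ A → y ≠ o → y ≠ x → (w s(x, y) : ℝ) = 0)
    (htwo : ∀ x : Fin n, x ∉ A → x ≠ o → (w s(o, x) : ℝ) ≠ 0 →
      ∀ a ∈ A, a ≠ w₁ → a ≠ w₂ → (w s(x, a) : ℝ) = 0) :
    ∀ t : ℝ, 0 ≤ t →
      (∀ a ∈ A, 1 - t ≤ (prodBernoulli w).real (openConn a b)) →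
      (prodBernoulli w).real (⋃ a ∈ A, openConn o a) - t ≤ (prodBernoulli w).real (openConn o b) := by
  refine additiveGluing_fingers_of_FML3_gen w A o b hb ho ?_ hfing
  intro K N d hNA _ hd hfin hKw hfree hle
  have hbo : b ≠ o := fun h => ho (h ▸ hb)
  have hvA : ∀ v ∈ N, v ∉ A := fun v hv => Finset.disjoint_left.1 hNA hv
  have htwoK : ∀ v ∈ N, ∀ a ∈ A, a ≠ w₁ → a ≠ w₂ → (K s(v, a) : ℝ) = 0 := by
    intro v hv a ha h1 h2
    have hao : a ≠ o := fun h => ho (h ▸ ha)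
    rw [hKw v a (hfin v hv).1 hao]
    exact htwo v (hvA v hv) (hfin v hv).1 (hfin v hv).2 a ha h1 h2
  have hintK : ∀ v ∈ N, ∀ v' ∈ N, v ≠ v' → (K s(v, v') : ℝ) = 0 := by
    intro v hv v' hv' hne
    rw [hKw v v' (hfin v hv).1 (hfin v' hv').1]
    exact hfing v (hvA v hv) (hfin v hv).1 (hfin v hv).2 v' (hvA v' hv') (hfin v' hv').1 (Ne.symm hne)
  exact fingerML3_twoTouched K A N d b w₁ w₂ hb hNA hd hw₁b hw₂b hfree hle htwoK hintK

end FingersTwoRelays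

end

end Summit.CriticalPhenomena.PercolationContinuityZ3.Theorems
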